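import Mathlib
import Summits.ValiantsHypothesis.ValiantsHypothesis.Theorems.LiouvilleSarnakLiouvilleCutRankStrayWindows
import Summits.ValiantsHypothesis.ValiantsHypothesis.Theorems.LiouvilleSarnakLiouvilleCutRankStrayWindowsBottom

/-!
# Route LiouvilleSarnak — crux `LiouvilleCutRank` (stmt-ValiantsHypothesis-14775):
# a LONG RUN ANYWHERE in a balanced window (R1 of the leafhand-2 g1 census)

`StrayRows.le_rank_of_strayWindow` / `le_rank_of_strayWindowBottom`
(`Theorems/LiouvilleSarnakLiouvilleCutRankStrayWindows{,Bottom}.lean`): a balanced window of length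
`2 n₁` (`n₁ ≥ n₀(W, k)`) whose TOP, resp. BOTTOM, `n₁ - k` positions are one letter has rank `≥ W`.

This file removes the END condition:

* ★ `le_rank_of_longRun` — for all `W, k` there is `n₀` such that for every `n₁ ≥ n₀`, at EVERY level
  `n`, every cut `π` with a balanced window `s, …, s + 2 n₁ - 1` containing `n₁ - k` CONSECUTIVE positions
  of one letter ANYWHERE (all row bits, or all column bits) has `rank M_π ≥ W`.

Proof (no new arithmetic): write the window as `x ρ y` with `ρ` the run (say of row letters, length
`L = n₁ - k`).  With `L_x = #C(x) - #R(x)` and `L_y = #C(y) - #R(y)` one has `L_x + L_y = L`, so one of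
them is `≥ T := ⌈L/2⌉`.  If `L_x ≥ T`, a discrete intermediate-value step (`exists_count_eq`) on the
suffixes of `x` gives a suffix `x'` with `#C(x') = #R(x') + T`; the window `x' R^T` is balanced of level
`#C(x') ≥ T`, its top `T` positions are row bits and it has `#R(x') ≤ k` strays, so
`le_rank_of_strayWindow` applies.  If `L_y ≥ T`, symmetrically a prefix `y'` of `y` gives the balanced
window `R^T y'` with a pure BOTTOM block, and `le_rank_of_strayWindowBottom` applies.  A column run is
the row run of the cut with rows and columns exchanged (transposed matrix, `Rectangles.cutNumber_swap`).

Honest framing: with this file the unconditional class for the OPEN crux `LiouvilleCutRank` contains every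
balanced window with a run of length `n₁ - k` (`k` fixed, `n₁` large) anywhere; bad windows (rank `< W`)
have ALL runs shorter than `n₁ - k` for every fixed `k`.  The crux for general (finely interleaved) cuts,
`DigitalBilinearLiouville` and `AlgebraicSarnak` stay OPEN; nothing here bears on VP versus VNP.
No definitions. [cite: Coons2011, Theorem 1.5]
-/

-- the directory `ValiantsHypothesis/ValiantsHypothesis` repeats the summit name (tree layout)
set_option linter.dupNamespace false

namespace Summit.ValiantsHypothesis.ValiantsHypothesis.Theorems.LiouvilleSarnakLiouvilleCutRank.LongRun

open ArithmeticFunction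

open Summit.ValiantsHypothesis.ValiantsHypothesis.Theorems.LiouvilleSarnakLiouvilleCutRank.StrayRows
  (le_rank_of_strayWindow le_rank_of_strayWindowBottom)
open Summit.ValiantsHypothesis.ValiantsHypothesis.Theorems.LiouvilleSarnakDigitalBilinearLiouville.Rectangles
  (cutNumber_swap)

/-! ### §1 Counting tools -/

/-- In a Boolean word, the letters `true` and `false` among the first `m` positions add up to `m`.
[folklore] -/
theorem count_true_add_count_false (v : ℕ → Bool) (m : ℕ) :
    Nat.count (fun i => v i = true) m + Nat.count (fun i => v i = false) m = m := by
  induction m with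
  | zero => simp
  | succ m ih =>
    rw [Nat.count_succ, Nat.count_succ]
    cases v m <;> simp <;> omega

/-- **Discrete intermediate values.**  If `2 · #{i < a : Q i} ≥ a + T` then for some `t ≤ a` one has
`2 · #{i < t : Q i} = t + T` exactly (the quantity `2 · count - t` moves by `±1` per step). [folklore] -/
theorem exists_count_eq (Q : ℕ → Prop) [DecidablePred Q] (a T : ℕ)
    (h : a + T ≤ 2 * Nat.count Q a) : ∃ t, t ≤ a ∧ 2 * Nat.count Q t = t + T := by
  have hex : ∃ t, t + T ≤ 2 * Nat.count Q t := ⟨a, h⟩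
  obtain ⟨t₀, ht₀, hmin⟩ : ∃ t₀, t₀ + T ≤ 2 * Nat.count Q t₀ ∧
      ∀ t, t < t₀ → ¬ (t + T ≤ 2 * Nat.count Q t) :=
    ⟨Nat.find hex, Nat.find_spec hex, fun t ht => Nat.find_min hex ht⟩
  have ht₀a : t₀ ≤ a := by
    by_contra hlt
    exact hmin a (by omega) h
  refine ⟨t₀, ht₀a, ?_⟩
  rcases Nat.eq_zero_or_pos t₀ with h0 | hpos
  · subst h0
    simp only [Nat.count_zero, mul_zero, nonpos_iff_eq_zero, add_eq_zero] at ht₀ ⊢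
    omega
  · obtain ⟨t₁, rfl⟩ : ∃ t₁, t₀ = t₁ + 1 := ⟨t₀ - 1, by omega⟩
    have hmin₁ := hmin t₁ (Nat.lt_succ_self t₁)
    have hstep : Nat.count Q (t₁ + 1) ≤ Nat.count Q t₁ + 1 := by
      rw [Nat.count_succ]; split_ifs <;> omega
    omega

/-- **Counting downward.**  Counting the letter `b` at the `t` positions just below `e`, downward from
`e - 1`, equals counting it upward from `e - t` (for `t ≤ e`). [folklore] -/
theorem count_reflect (v : ℕ → Bool) (e : ℕ) (b : Bool) : ∀ t : ℕ, t ≤ e →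
    Nat.count (fun i => v (e - 1 - i) = b) t = Nat.count (fun q => v (e - t + q) = b) t := by
  intro t
  induction t with
  | zero => intro _; simp
  | succ t ih =>
    intro ht
    rw [Nat.count_succ, ih (by omega), Nat.count_succ']
    have h1 : Nat.count (fun q => v (e - (t + 1) + (q + 1)) = b) t =
        Nat.count (fun q => v (e - t + q) = b) t := by
      congr 1; funext q; rw [show e - (t + 1) + (q + 1) = e - t + q by omega]
    rw [h1, show e - (t + 1) + 0 = e - 1 - t by omega]

/-! ### §2 A threshold uniform in the number of strays, for both end-block theorems -/

/-- One level bound `N = N(W, k)` from which both `le_rank_of_strayWindow W k'` and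
`le_rank_of_strayWindowBottom W k'` hold, for every `k' ≤ k`. [folklore] -/
theorem exists_uniform_threshold₂ (W k : ℕ) : ∃ N : ℕ, ∀ k' : ℕ, k' ≤ k →
    (∀ n₁ : ℕ, N ≤ n₁ →
      ∀ (n : ℕ) (π : Fin n ⊕ Fin n ≃ Fin (2 * n)) (s : ℕ), s + 2 * n₁ ≤ 2 * n →
        Nat.count (fun k' => (if h : s + k' < 2 * n then (π.symm ⟨s + k', h⟩).isLeft else false) = true)
          (2 * n₁) = n₁ →
        ((∀ j : Fin (2 * n), s + (n₁ + k') ≤ (j : ℕ) → (j : ℕ) < s + 2 * n₁ → (π.symm j).isLeft = true) ∨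
         (∀ j : Fin (2 * n), s + (n₁ + k') ≤ (j : ℕ) → (j : ℕ) < s + 2 * n₁ →
           (π.symm j).isRight = true)) →
        W ≤ (Matrix.of fun r c : Fin n → Bool =>
          (((liouville (Nat.ofBits (fun j : Fin (2 * n) => Sum.elim r c (π.symm j)) + 1) : ℤ) :
            ℂ))).rank) ∧
    (∀ n₁ : ℕ, N ≤ n₁ →
      ∀ (n : ℕ) (π : Fin n ⊕ Fin n ≃ Fin (2 * n)) (s : ℕ), s + 2 * n₁ ≤ 2 * n →
        Nat.count (fun k' => (if h : s + k' < 2 * n then (π.symm ⟨s + k', h⟩).isLeft else false) = true)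
          (2 * n₁) = n₁ →
        ((∀ j : Fin (2 * n), s ≤ (j : ℕ) → (j : ℕ) < s + (n₁ - k') → (π.symm j).isLeft = true) ∨
         (∀ j : Fin (2 * n), s ≤ (j : ℕ) → (j : ℕ) < s + (n₁ - k') → (π.symm j).isRight = true)) →
        W ≤ (Matrix.of fun r c : Fin n → Bool =>
          (((liouville (Nat.ofBits (fun j : Fin (2 * n) => Sum.elim r c (π.symm j)) + 1) : ℤ) :
            ℂ))).rank) := by
  choose f hf using fun k' => le_rank_of_strayWindow W k'
  choose g hg using fun k' => le_rank_of_strayWindowBottom W k'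
  refine ⟨∑ k' ∈ Finset.range (k + 1), (f k' + g k'), fun k' hk' => ⟨fun n₁ hn₁ => hf k' n₁ ?_,
    fun n₁ hn₁ => hg k' n₁ ?_⟩⟩
  · have : f k' + g k' ≤ ∑ k' ∈ Finset.range (k + 1), (f k' + g k') :=
      Finset.single_le_sum (f := fun k' => f k' + g k') (fun _ _ => Nat.zero_le _)
        (Finset.mem_range.mpr (Nat.lt_succ_of_le hk'))
    omega
  · have : f k' + g k' ≤ ∑ k' ∈ Finset.range (k + 1), (f k' + g k') :=
      Finset.single_le_sum (f := fun k' => f k' + g k') (fun _ _ => Nat.zero_le _)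
        (Finset.mem_range.mpr (Nat.lt_succ_of_le hk'))
    omega

/-! ### §3 A long run of ROW letters anywhere in a balanced window -/

/-- **A long row run anywhere.**  For all `W, k` there is `n₀` such that for `n₁ ≥ n₀`, at every level
`n`, a cut `π` with a balanced window `s, …, s + 2 n₁ - 1` whose positions `s + a, …, s + a + (n₁ - k) - 1`
are all row bits has `rank M_π ≥ W`. [cite: Coons2011, Theorem 1.5] -/
theorem le_rank_of_longRowRun (W k : ℕ) : ∃ n₀ : ℕ, ∀ n₁ : ℕ, n₀ ≤ n₁ →
    ∀ (n : ℕ) (π : Fin n ⊕ Fin n ≃ Fin (2 * n)) (s : ℕ), s + 2 * n₁ ≤ 2 * n →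
      Nat.count (fun k' => (if h : s + k' < 2 * n then (π.symm ⟨s + k', h⟩).isLeft else false) = true)
        (2 * n₁) = n₁ →
      ∀ a : ℕ, a + (n₁ - k) ≤ 2 * n₁ →
      (∀ j : Fin (2 * n), s + a ≤ (j : ℕ) → (j : ℕ) < s + a + (n₁ - k) → (π.symm j).isLeft = true) →
      W ≤ (Matrix.of fun r c : Fin n → Bool =>
        (((liouville (Nat.ofBits (fun j : Fin (2 * n) => Sum.elim r c (π.symm j)) + 1) : ℤ) :
          ℂ))).rank := by
  obtain ⟨N, hN⟩ := exists_uniform_threshold₂ W k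
  refine ⟨2 * N + k + 1, fun n₁ hn₁ n π s hs hbal a ha hrun => ?_⟩
  -- the row/column word of `π` (`true` = row bit), extended by `false`
  set w : ℕ → Bool := fun k' => if h : k' < 2 * n then (π.symm ⟨k', h⟩).isLeft else false with hw
  have hbal' : Nat.count (fun q => w (s + q) = true) (2 * n₁) = n₁ := by simpa [hw] using hbal
  -- the run `ρ = [s + a, s + a + L)`, the parts `x = [s, s + a)` and `y = [s + a + L, s + 2 n₁)`
  set L : ℕ := n₁ - k with hL
  have hL1 : 1 ≤ L := by omega
  set m : ℕ := 2 * n₁ - a - L with hm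
  have hdecomp : 2 * n₁ = a + (L + m) := by omega
  have hrunw : ∀ q, q < L → w (s + a + q) = true := by
    intro q hq
    have hlt : s + a + q < 2 * n := by omega
    simp only [hw, dif_pos hlt]
    exact hrun ⟨s + a + q, hlt⟩ (by simp only; omega) (by simp only; omega)
  -- row letters in `x` and in `y`
  set rx : ℕ := Nat.count (fun q => w (s + q) = true) a with hrx
  set ry : ℕ := Nat.count (fun q => w (s + (a + L) + q) = true) m with hry
  have hrx_le : rx ≤ a := by rw [hrx]; exact Nat.count_le _
  have hry_le : ry ≤ m := by rw [hry]; exact Nat.count_le _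
  have hsplit : n₁ = rx + L + ry := by
    have h := hbal'
    rw [hdecomp, Nat.count_add, Nat.count_add] at h
    have hrunc : Nat.count (fun q => w (s + (a + q)) = true) L = L :=
      Nat.count_iff_forall.mpr fun q hq => by rw [← Nat.add_assoc]; exact hrunw q hq
    have h3 : Nat.count (fun q => w (s + (a + (L + q))) = true) m = ry := by
      rw [hry]
      congr 1
      funext q
      rw [show s + (a + (L + q)) = s + (a + L) + q by omega]
    rw [hrunc, h3] at h
    omega
  -- column letters in `x` and in `y`
  have hcx : Nat.count (fun q => w (s + q) = false) a = a - rx := by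
    have := count_true_add_count_false (fun q => w (s + q)) a
    omega
  have hcy : Nat.count (fun q => w (s + (a + L) + q) = false) m = m - ry := by
    have := count_true_add_count_false (fun q => w (s + (a + L) + q)) m
    omega
  -- half the run suffices
  set T : ℕ := L - L / 2 with hT
  have hT1 : 1 ≤ T := by omega
  have hTL : T ≤ L := by omega
  have hTN : N ≤ T := by omega
  by_cases hx : a + T ≤ 2 * (a - rx)
  · /- the surplus of column letters below the run is at least `T`: a suffix `x'` of `x` with
       `#C(x') = #R(x') + T`, and the balanced window `x' R^T` with a pure top block -/
    have hQa : Nat.count (fun i => w (s + a - 1 - i) = false) a = a - rx := by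
      rw [count_reflect w (s + a) false a (by omega), show s + a - a = s by omega]
      exact hcx
    obtain ⟨t, hta, ht⟩ := exists_count_eq (fun i => w (s + a - 1 - i) = false) a T
      (by rw [hQa]; exact hx)
    set n₁' : ℕ := Nat.count (fun i => w (s + a - 1 - i) = false) t with hn₁'
    set s' : ℕ := s + a - t with hs'
    have hn₁'t : n₁' ≤ t := by rw [hn₁']; exact Nat.count_le _
    have hCt : Nat.count (fun q => w (s' + q) = false) t = n₁' := by
      rw [hn₁', count_reflect w (s + a) false t (by omega)]
    have hRt : Nat.count (fun q => w (s' + q) = true) t = t - n₁' := by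
      have := count_true_add_count_false (fun q => w (s' + q)) t
      omega
    -- the strays of the sub-window: the row letters of `x'`, at most `rx ≤ k` of them
    have hk'le : t - n₁' ≤ k := by
      have hsub : Nat.count (fun q => w (s' + q) = true) t ≤ rx := by
        rw [hrx, show a = (a - t) + t by omega, Nat.count_add]
        have : Nat.count (fun q => w (s + ((a - t) + q)) = true) t =
            Nat.count (fun q => w (s' + q) = true) t := by
          congr 1; funext q; rw [show s + ((a - t) + q) = s' + q by omega]
        rw [this]
        omega
      omega
    have hs'le : s' + 2 * n₁' ≤ 2 * n := by omega
    have hcount : Nat.count (fun q => w (s' + q) = true) (2 * n₁') = n₁' := by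
      rw [ht, Nat.count_add, hRt]
      have : Nat.count (fun q => w (s' + (t + q)) = true) T = T :=
        Nat.count_iff_forall.mpr fun q hq => by
          rw [show s' + (t + q) = s + a + q by omega]; exact hrunw q (by omega)
      rw [this]
      omega
    have htop : ∀ j : Fin (2 * n), s' + (n₁' + (t - n₁')) ≤ (j : ℕ) → (j : ℕ) < s' + 2 * n₁' →
        (π.symm j).isLeft = true :=
      fun j hj hj' => hrun j (by omega) (by omega)
    have key := (hN (t - n₁') hk'le).1 n₁' (by omega) n π s' hs'le (by simpa [hw] using hcount)
      (Or.inl htop)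
    exact key
  · /- the surplus of column letters above the run is at least `T`: a prefix `y'` of `y` with
       `#C(y') = #R(y') + T`, and the balanced window `R^T y'` with a pure bottom block -/
    have hy : m + T ≤ 2 * (m - ry) := by omega
    obtain ⟨t, htm, ht⟩ := exists_count_eq (fun q => w (s + (a + L) + q) = false) m T
      (by rw [hcy]; exact hy)
    set n₁' : ℕ := Nat.count (fun q => w (s + (a + L) + q) = false) t with hn₁'
    set s' : ℕ := s + (a + L) - T with hs'
    have hn₁'t : n₁' ≤ t := by rw [hn₁']; exact Nat.count_le _
    have hRt : Nat.count (fun q => w (s + (a + L) + q) = true) t = t - n₁' := by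
      have := count_true_add_count_false (fun q => w (s + (a + L) + q)) t
      omega
    -- the strays: the row letters of `y'`, at most `ry ≤ k` of them
    have hk'le : t - n₁' ≤ k := by
      have hsub : Nat.count (fun q => w (s + (a + L) + q) = true) t ≤ ry := by
        rw [hry]; exact Nat.count_monotone _ htm
      omega
    have hs'le : s' + 2 * n₁' ≤ 2 * n := by omega
    have hcount : Nat.count (fun q => w (s' + q) = true) (2 * n₁') = n₁' := by
      rw [show 2 * n₁' = T + t by omega, Nat.count_add]
      have h1 : Nat.count (fun q => w (s' + q) = true) T = T :=
        Nat.count_iff_forall.mpr fun q hq => by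
          rw [show s' + q = s + a + (L - T + q) by omega]; exact hrunw (L - T + q) (by omega)
      have h2 : Nat.count (fun q => w (s' + (T + q)) = true) t =
          Nat.count (fun q => w (s + (a + L) + q) = true) t := by
        congr 1; funext q; rw [show s' + (T + q) = s + (a + L) + q by omega]
      rw [h1, h2, hRt]
      omega
    have hbot : ∀ j : Fin (2 * n), s' ≤ (j : ℕ) → (j : ℕ) < s' + (n₁' - (t - n₁')) →
        (π.symm j).isLeft = true :=
      fun j hj hj' => hrun j (by omega) (by omega)
    have key := (hN (t - n₁') hk'le).2 n₁' (by omega) n π s' hs'le (by simpa [hw] using hcount)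
      (Or.inl hbot)
    exact key

/-! ### §4 Either letter -/

/-- ★ **A long run anywhere.**  For all `W, k` there is `n₀` such that for every `n₁ ≥ n₀`, at EVERY
level `n`, every cut `π` of the `2n` bit positions with a balanced window `s, …, s + 2 n₁ - 1` (exactly
`n₁` row bits) containing `n₁ - k` consecutive positions that are all row bits, or all column bits, has
`rank M_π ≥ W` (`M_π(r,c) = λ(N_π(r,c) + 1)`).  Equivalently: for fixed `W, k`, a balanced window of
rank `< W` and level `n₁ ≥ n₀` has every run shorter than `n₁ - k`. [cite: Coons2011, Theorem 1.5] -/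
theorem le_rank_of_longRun (W k : ℕ) : ∃ n₀ : ℕ, ∀ n₁ : ℕ, n₀ ≤ n₁ →
    ∀ (n : ℕ) (π : Fin n ⊕ Fin n ≃ Fin (2 * n)) (s : ℕ), s + 2 * n₁ ≤ 2 * n →
      Nat.count (fun k' => (if h : s + k' < 2 * n then (π.symm ⟨s + k', h⟩).isLeft else false) = true)
        (2 * n₁) = n₁ →
      ∀ a : ℕ, a + (n₁ - k) ≤ 2 * n₁ →
      ((∀ j : Fin (2 * n), s + a ≤ (j : ℕ) → (j : ℕ) < s + a + (n₁ - k) → (π.symm j).isLeft = true) ∨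
       (∀ j : Fin (2 * n), s + a ≤ (j : ℕ) → (j : ℕ) < s + a + (n₁ - k) → (π.symm j).isRight = true)) →
      W ≤ (Matrix.of fun r c : Fin n → Bool =>
        (((liouville (Nat.ofBits (fun j : Fin (2 * n) => Sum.elim r c (π.symm j)) + 1) : ℤ) :
          ℂ))).rank := by
  obtain ⟨n₀, hn₀⟩ := le_rank_of_longRowRun W k
  refine ⟨n₀, fun n₁ hn₁ n π s hs hbal a ha hrun => ?_⟩
  rcases hrun with hrun | hrun
  · exact hn₀ n₁ hn₁ n π s hs hbal a ha hrun
  · -- exchange rows and columns: transposed matrix, same rank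
    set π' : Fin n ⊕ Fin n ≃ Fin (2 * n) := (Equiv.sumComm (Fin n) (Fin n)).trans π with hπ'
    have hswap : ∀ j : Fin (2 * n), (π'.symm j).isLeft = (π.symm j).isRight := by
      intro j
      rw [hπ', Equiv.symm_trans_apply, Equiv.sumComm_symm, Equiv.sumComm_apply, Sum.isLeft_swap]
    have hrun' : ∀ j : Fin (2 * n), s + a ≤ (j : ℕ) → (j : ℕ) < s + a + (n₁ - k) →
        (π'.symm j).isLeft = true := fun j hj hj' => by rw [hswap]; exact hrun j hj hj'
    have hbal' : Nat.count
        (fun k' => (if h : s + k' < 2 * n then (π'.symm ⟨s + k', h⟩).isLeft else false) = true)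
        (2 * n₁) = n₁ := by
      have hc := count_true_add_count_false
        (fun k' => if h : s + k' < 2 * n then (π.symm ⟨s + k', h⟩).isLeft else false) (2 * n₁)
      rw [hbal] at hc
      have hiff : ∀ k' < 2 * n₁,
          ((if h : s + k' < 2 * n then (π'.symm ⟨s + k', h⟩).isLeft else false) = true ↔
           (if h : s + k' < 2 * n then (π.symm ⟨s + k', h⟩).isLeft else false) = false) := by
        intro k' hk'
        have h : s + k' < 2 * n := by omega
        simp only [dif_pos h, hswap, ← Sum.not_isLeft]
        cases (π.symm ⟨s + k', h⟩).isLeft <;> simp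
      have h1 := Nat.count_mono_left (n := 2 * n₁)
        (p := fun k' => (if h : s + k' < 2 * n then (π'.symm ⟨s + k', h⟩).isLeft else false) = true)
        (q := fun k' => (if h : s + k' < 2 * n then (π.symm ⟨s + k', h⟩).isLeft else false) = false)
        (fun k' hk' h => (hiff k' hk').mp h)
      have h2 := Nat.count_mono_left (n := 2 * n₁)
        (p := fun k' => (if h : s + k' < 2 * n then (π.symm ⟨s + k', h⟩).isLeft else false) = false)
        (q := fun k' => (if h : s + k' < 2 * n then (π'.symm ⟨s + k', h⟩).isLeft else false) = true)
        (fun k' hk' h => (hiff k' hk').mpr h)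
      omega
    have key := hn₀ n₁ hn₁ n π' s hs hbal' a ha hrun'
    have hT : (Matrix.of fun r c : Fin n → Bool =>
        (((liouville (Nat.ofBits (fun j : Fin (2 * n) => Sum.elim r c (π'.symm j)) + 1) : ℤ) :
          ℂ))) =
        (Matrix.of fun r c : Fin n → Bool =>
          (((liouville (Nat.ofBits (fun j : Fin (2 * n) => Sum.elim r c (π.symm j)) + 1) : ℤ) :
            ℂ))).transpose := by
      ext c r
      rw [Matrix.transpose_apply, Matrix.of_apply, Matrix.of_apply, hπ', cutNumber_swap]
    rw [hT, Matrix.rank_transpose] at key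
    exact key

end Summit.ValiantsHypothesis.ValiantsHypothesis.Theorems.LiouvilleSarnakLiouvilleCutRank.LongRun
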